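import Mathlib.Analysis.SpecialFunctions.Trigonometric.InverseDeriv
import Mathlib.Analysis.SpecialFunctions.ImproperIntegrals
import Mathlib.LinearAlgebra.Matrix.SchurComplement
import Literature.NumberTheory.Transcendental.KZBallVolume
import Literature.NumberTheory.Transcendental.KZBetaChains
import Literature.NumberTheory.Transcendental.KZDirichletPeeling
import Literature.NumberTheory.Transcendental.KZSemialgebraicComplex

/-!
# The Cauchy chart `y ↦ y/√(1+|y|²)` of `ℝⁿ` onto the unit ball, inside the Kontsevich–Zagier rules

Helper file for item stmt-KontsevichZagierPeriods-5570 (`CP2Volume`, route CobordismMove):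
generic, fully proved move lemmas of the Kontsevich–Zagier calculus (Kontsevich–Zagier 2001, §1.2)
for representations PINNED by domain and integrand.

* `det_one_add_smulRight`, `det_smul_id_add_smulRight` — the rank-one determinant lemma on `ℝⁿ`;
* `exists_cauchyChart` — the chart `Ψ(y) = y / √(1 + |y|²)` of `ℝⁿ`, its derivative
  `Ψ'(y) = g • id + (Dg)(y) ⊗ y` (`g = (√(1+|y|²))⁻¹`) and `det Ψ'(y) = g^{n+2}`;
  `isSemialgebraicMapOn_cauchy`, `injective_cauchy`, `range_cauchy` (`Ψ(ℝⁿ) = Bₙ`);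
* `of_sub_of_mem_relations_cauchy` — THE ENGINE: `[ℝⁿ, f] − [Bₙ, f'] ∈ KZ.relations` as soon as
  `f(y) = f'(Ψ y) · g(y)^{n+2}`, ONE change of variables (rule 2);
* `exists_cauchyRep₁` (`[ℝ, 1/(1+y²)]`), `exists_arcsineRep` (`[(−1,1), (1−x²)^{−1/2}]`,
  integrable as the derivative of `arcsin`);
* `symInterval_one_equivalent` — `[(−1,1), 1] ∼ [pt, 2]`, ONE Newton–Leibniz move (primitive `t`);
* `two_mul_toFormalPeriod_unit_constMul_half` — `2 · ⟦[pt, 1/2]⟧ = 1` in the formal period ring.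

Everything is proved; no `def`, no named fact.
-/

noncomputable section

open MeasureTheory Set
open Literature.NumberTheory.Transcendental Literature.NumberTheory.Transcendental.KZ
open Literature.ModelTheory.ExponentialFields (IsSemialgebraic isSemialgebraic_univ
  isSemialgebraic_setOf_eval_le)
open MvPolynomial (aeval X C)

namespace Summit.KontsevichZagierPeriods.CobordismMove.CP2Volume

variable {n : ℕ}

/-! ## The rank-one determinant lemma on `ℝⁿ` -/

/-- **Rank-one determinant lemma** on `ℝⁿ`: `det (1 + x ⊗ f) = 1 + f x` for a linear form `f`
and a vector `x` (`Matrix.det_one_add_replicateCol_mul_replicateRow` in the standard basis).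
[folklore] -/
theorem det_one_add_smulRight (f : (Fin n → ℝ) →ₗ[ℝ] ℝ) (x : Fin n → ℝ) :
    LinearMap.det (1 + f.smulRight x) = 1 + f x := by
  classical
  let b := Module.finBasis ℝ (Fin n → ℝ)
  rw [← LinearMap.det_toMatrix b, map_add, LinearMap.toMatrix_one, LinearMap.toMatrix_smulRight,
    Matrix.vecMulVec_eq (Fin 1), Matrix.det_one_add_replicateCol_mul_replicateRow]
  congr 1
  calc (f ∘ b) ⬝ᵥ (b.repr x) = ∑ i, (b.repr x) i * f (b i) := by
        simp [dotProduct, mul_comm]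
    _ = f (∑ i, (b.repr x) i • b i) := by rw [_root_.map_sum]; simp
    _ = f x := by rw [b.sum_repr]

/-- `det (c • id + x ⊗ f) = cⁿ (1 + c⁻¹ f x)` on `ℝⁿ` for `c ≠ 0`. [folklore] -/
theorem det_smul_id_add_smulRight {c : ℝ} (hc : c ≠ 0) (f : (Fin n → ℝ) →L[ℝ] ℝ)
    (x : Fin n → ℝ) :
    (c • ContinuousLinearMap.id ℝ (Fin n → ℝ) + f.smulRight x).det = c ^ n * (1 + c⁻¹ * f x) := by
  have h1 : ((c • ContinuousLinearMap.id ℝ (Fin n → ℝ) + f.smulRight x :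
      (Fin n → ℝ) →L[ℝ] (Fin n → ℝ)) : (Fin n → ℝ) →ₗ[ℝ] (Fin n → ℝ)) =
      c • (1 + ((c⁻¹ • (f : (Fin n → ℝ) →ₗ[ℝ] ℝ))).smulRight x) := by
    refine LinearMap.ext fun v => ?_
    simp [smul_smul, mul_inv_cancel_left₀ hc]
  change LinearMap.det ((c • ContinuousLinearMap.id ℝ (Fin n → ℝ) + f.smulRight x :
      (Fin n → ℝ) →L[ℝ] (Fin n → ℝ)) : (Fin n → ℝ) →ₗ[ℝ] (Fin n → ℝ)) = _
  rw [h1, LinearMap.det_smul, det_one_add_smulRight, Module.finrank_fin_fun]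
  simp

/-! ## The Cauchy chart `Ψ(y) = y / √(1 + |y|²)` -/

/-- **The Cauchy chart.** On `ℝⁿ` the map `Ψ(y) = g(y) • y`, `g(y) = (√(1 + |y|²))⁻¹`, is
differentiable everywhere with derivative `g(y) • id + Dg(y) ⊗ y`, whose determinant is
`g(y)ⁿ (1 + g(y)⁻¹ Dg(y)[y]) = g(y)ⁿ⁺²` (rank-one determinant lemma; `Dg(y)[y] = −|y|² g(y)³`).
[folklore] -/
theorem exists_cauchyChart (n : ℕ) :
    ∃ (Φ : (Fin n → ℝ) → (Fin n → ℝ)) (Φ' : (Fin n → ℝ) → (Fin n → ℝ) →L[ℝ] (Fin n → ℝ)),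
      (∀ y i, Φ y i = (√(1 + ∑ j, (y j) ^ 2))⁻¹ * y i) ∧
      (∀ y, HasFDerivAt Φ (Φ' y) y) ∧
      (∀ y, (Φ' y).det = ((√(1 + ∑ j, (y j) ^ 2))⁻¹) ^ (n + 2)) := by
  -- the derivative of `u(y) = 1 + |y|²`
  set Du : (Fin n → ℝ) → (Fin n → ℝ) →L[ℝ] ℝ := fun y =>
    ∑ j, (2 * y j) • ContinuousLinearMap.proj (R := ℝ) (φ := fun _ : Fin n => ℝ) j with hDu
  have hu : ∀ y, HasFDerivAt (fun z : Fin n → ℝ => 1 + ∑ j, z j ^ 2) (Du y) y := by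
    intro y
    have hsq : ∀ j : Fin n, HasFDerivAt (fun z : Fin n → ℝ => z j ^ 2)
        ((2 * y j) • ContinuousLinearMap.proj (R := ℝ) (φ := fun _ : Fin n => ℝ) j) y := by
      intro j
      refine ((hasFDerivAt_apply (𝕜 := ℝ) j y).pow 2).congr_fderiv ?_
      ext v
      simp
    exact (HasFDerivAt.fun_sum fun j _ => hsq j).const_add 1
  have hupos : ∀ y : Fin n → ℝ, 0 < 1 + ∑ j, y j ^ 2 := fun y => by positivity
  -- the scalar factor `g = h ∘ u`, `h(t) = (√t)⁻¹`
  set h' : ℝ → ℝ := fun t => -(1 / (2 * √t)) / (√t) ^ 2 with hh'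
  have hh : ∀ t : ℝ, 0 < t → HasDerivAt (fun s => (√s)⁻¹) (h' t) t := by
    intro t ht
    have h1 := (Real.hasDerivAt_sqrt ht.ne').inv (Real.sqrt_pos.2 ht).ne'
    exact h1
  set Dg : (Fin n → ℝ) → (Fin n → ℝ) →L[ℝ] ℝ := fun y => h' (1 + ∑ j, y j ^ 2) • Du y with hDg
  have hg : ∀ y, HasFDerivAt (fun z : Fin n → ℝ => (√(1 + ∑ j, z j ^ 2))⁻¹) (Dg y) y := by
    intro y
    have := (hh _ (hupos y)).comp_hasFDerivAt y (hu y)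
    exact this
  set Φ : (Fin n → ℝ) → (Fin n → ℝ) := fun y => (√(1 + ∑ j, (y j) ^ 2))⁻¹ • y with hΦ
  set Φ' : (Fin n → ℝ) → (Fin n → ℝ) →L[ℝ] (Fin n → ℝ) := fun y =>
    (√(1 + ∑ j, (y j) ^ 2))⁻¹ • ContinuousLinearMap.id ℝ (Fin n → ℝ) + (Dg y).smulRight y
    with hΦ'
  refine ⟨Φ, Φ', fun y i => by simp [hΦ], fun y => ?_, fun y => ?_⟩
  · have := (hg y).smul (hasFDerivAt_id (𝕜 := ℝ) y)
    simpa [hΦ', hΦ] using this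
  · have hgpos : 0 < (√(1 + ∑ j, (y j) ^ 2))⁻¹ := inv_pos.2 (Real.sqrt_pos.2 (hupos y))
    rw [hΦ', det_smul_id_add_smulRight hgpos.ne']
    -- `Dg(y)[y] = h'(u) · 2|y|²`
    have hDuy : Du y y = 2 * ∑ j, y j ^ 2 := by
      simp only [hDu, _root_.sum_apply, _root_.smul_apply, ContinuousLinearMap.proj_apply,
        smul_eq_mul, Finset.mul_sum]
      exact Finset.sum_congr rfl fun j _ => by ring
    have hDgy : Dg y y = h' (1 + ∑ j, y j ^ 2) * (2 * ∑ j, y j ^ 2) := by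
      simp only [hDg, _root_.smul_apply, smul_eq_mul, hDuy]
    rw [hDgy, hh']
    set u : ℝ := 1 + ∑ j, y j ^ 2 with hu_def
    have hu0 : 0 < u := hupos y
    have hsq : √u ^ 2 = u := Real.sq_sqrt hu0.le
    have hsqpos : 0 < √u := Real.sqrt_pos.2 hu0
    have hs : ∑ j, y j ^ 2 = u - 1 := by rw [hu_def]; ring
    rw [hs, pow_add, inv_pow, inv_pow, hsq]
    field_simp
    rw [hsq]
    ring

/-- The Cauchy chart is a `ℚ`-semialgebraic map on every `ℚ`-semialgebraic set (coordinates
`y_i · (√(1 + |y|²))⁻¹`: polynomial, square root, inverse, product). [folklore] -/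
theorem isSemialgebraicMapOn_cauchy (Φ : (Fin n → ℝ) → (Fin n → ℝ))
    (hΦ : ∀ y i, Φ y i = (√(1 + ∑ j, (y j) ^ 2))⁻¹ * y i)
    {s : Set (Fin n → ℝ)} (hs : IsSemialgebraic ℚ s) : IsSemialgebraicMapOn ℚ s Φ := by
  refine IsSemialgebraicMapOn.of_forall hs fun i => ?_
  have h1 : IsSemialgebraicFunOn ℚ s (fun y => √(aeval y
      (1 + ∑ j, (X j : MvPolynomial (Fin n) ℚ) ^ 2))) :=
    IsSemialgebraicFunOn.sqrt_holds (isSemialgebraicFunOn_aeval hs _)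
  have h2 : IsSemialgebraicFunOn ℚ s (fun y => (√(aeval y
      (1 + ∑ j, (X j : MvPolynomial (Fin n) ℚ) ^ 2)))⁻¹) := by
    refine h1.inv fun y _ => ?_
    have hy : (0 : ℝ) < 1 + ∑ j, (y j) ^ 2 := by positivity
    simp only [map_add, map_one, map_sum, map_pow, MvPolynomial.aeval_X]
    exact (Real.sqrt_pos.2 hy).ne'
  refine (IsSemialgebraicFunOn.mul_holds h2 (isSemialgebraicFunOn_aeval hs (X i))).congr
    fun y _ => ?_
  simp [hΦ]

/-- The Cauchy chart is injective (`|Ψ y|² = |y|²/(1+|y|²)` recovers `|y|²`, hence `g(y)`).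
[folklore] -/
theorem injective_cauchy (Φ : (Fin n → ℝ) → (Fin n → ℝ))
    (hΦ : ∀ y i, Φ y i = (√(1 + ∑ j, (y j) ^ 2))⁻¹ * y i) : Function.Injective Φ := by
  intro x y hxy
  set gx : ℝ := (√(1 + ∑ j, (x j) ^ 2))⁻¹ with hgx
  set gy : ℝ := (√(1 + ∑ j, (y j) ^ 2))⁻¹ with hgy
  have hxpos : (0 : ℝ) < 1 + ∑ j, (x j) ^ 2 := by positivity
  have hypos : (0 : ℝ) < 1 + ∑ j, (y j) ^ 2 := by positivity
  have h : ∀ i, gx * x i = gy * y i := fun i => by rw [hgx, hgy, ← hΦ x i, ← hΦ y i, hxy]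
  have hgx2 : gx ^ 2 = (1 + ∑ j, (x j) ^ 2)⁻¹ := by rw [hgx, inv_pow, Real.sq_sqrt hxpos.le]
  have hgy2 : gy ^ 2 = (1 + ∑ j, (y j) ^ 2)⁻¹ := by rw [hgy, inv_pow, Real.sq_sqrt hypos.le]
  have hsum : gx ^ 2 * ∑ j, (x j) ^ 2 = gy ^ 2 * ∑ j, (y j) ^ 2 := by
    rw [Finset.mul_sum, Finset.mul_sum]
    exact Finset.sum_congr rfl fun j _ => by rw [← mul_pow, ← mul_pow, h j]
  have hs : ∑ j, (x j) ^ 2 = ∑ j, (y j) ^ 2 := by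
    rw [hgx2, hgy2] at hsum
    field_simp at hsum
    linarith
  have hg : gx = gy := by rw [hgx, hgy, hs]
  have hgpos : 0 < gx := inv_pos.2 (Real.sqrt_pos.2 hxpos)
  funext i
  exact mul_left_cancel₀ hgpos.ne' (by rw [h i, hg])

/-- **The Cauchy chart maps `ℝⁿ` ONTO the open unit ball** (inverse `x ↦ x / √(1 − |x|²)`).
[folklore] -/
theorem range_cauchy (Φ : (Fin n → ℝ) → (Fin n → ℝ))
    (hΦ : ∀ y i, Φ y i = (√(1 + ∑ j, (y j) ^ 2))⁻¹ * y i) :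
    Set.range Φ = {x | ∑ i, (x i) ^ 2 < 1} := by
  ext x
  constructor
  · rintro ⟨y, rfl⟩
    have hypos : (0 : ℝ) < 1 + ∑ j, (y j) ^ 2 := by positivity
    have hg2 : ((√(1 + ∑ j, (y j) ^ 2))⁻¹) ^ 2 = (1 + ∑ j, (y j) ^ 2)⁻¹ := by
      rw [inv_pow, Real.sq_sqrt hypos.le]
    show ∑ i, (Φ y i) ^ 2 < 1
    simp only [hΦ, mul_pow, ← Finset.mul_sum, hg2]
    rw [inv_mul_lt_iff₀ hypos]
    linarith
  · intro hx
    have hx' : ∑ i, (x i) ^ 2 < 1 := hx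
    set L : ℝ := √(1 - ∑ i, (x i) ^ 2) with hL
    have hLpos : 0 < L := Real.sqrt_pos.2 (sub_pos.2 hx')
    have hL2 : L ^ 2 = 1 - ∑ i, (x i) ^ 2 := Real.sq_sqrt (sub_pos.2 hx').le
    refine ⟨fun i => L⁻¹ * x i, funext fun i => ?_⟩
    have hsum : 1 + ∑ j, (L⁻¹ * x j) ^ 2 = (L ^ 2)⁻¹ := by
      simp only [mul_pow, ← Finset.mul_sum, inv_pow]
      field_simp
      linarith
    rw [hΦ, hsum, Real.sqrt_inv, inv_inv, Real.sqrt_sq hLpos.le]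
    field_simp

/-! ## The engine: one change of variables -/

/-- **`[ℝⁿ, f] ∼ [Bₙ, f']` along the Cauchy chart.** For representations pinned as `r = [ℝⁿ, f]`
and `r' = [Bₙ, f']` with `f(y) = f'(y/√(1+|y|²)) · (√(1+|y|²))^{-(n+2)}` on `ℝⁿ`:
`[r] − [r'] ∈ KZ.relations`, by ONE change of variables (Kontsevich–Zagier's rule (2)) along
`Ψ(y) = y/√(1+|y|²)`, a `ℚ`-semialgebraic diffeomorphism of `ℝⁿ` onto the open unit ball with
`|det DΨ| = (1+|y|²)^{-(n+2)/2}`. [cite: KontsevichZagier2001, §1.2 rule (2)] -/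
theorem of_sub_of_mem_relations_cauchy (r r' : IntegralRep n) (hrd : r.domain = univ)
    (hr'd : r'.domain = {x | ∑ i, (x i) ^ 2 < 1})
    (hi : ∀ y, r.integrand y = r'.integrand (fun i => (√(1 + ∑ j, (y j) ^ 2))⁻¹ * y i) *
      ((√(1 + ∑ j, (y j) ^ 2))⁻¹) ^ (n + 2)) :
    of r - of r' ∈ relations := by
  obtain ⟨Φ, Φ', hΦ, hder, hdet⟩ := exists_cauchyChart n
  have hΦ' : ∀ y, Φ y = fun i => (√(1 + ∑ j, (y j) ^ 2))⁻¹ * y i := fun y => funext (hΦ y)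
  refine changeOfVariablesRel_subset_relations ⟨n, r, r', Φ, Φ', ?_,
    fun y _ => (hder y).hasFDerivWithinAt, (injective_cauchy Φ hΦ).injOn, ?_, fun y _ => ?_, rfl⟩
  · exact isSemialgebraicMapOn_cauchy Φ hΦ r.isSemialgebraic_domain
  · rw [hr'd, hrd, image_univ, range_cauchy Φ hΦ]
  · rw [hi y, hdet y, hΦ' y, abs_of_nonneg (pow_nonneg (inv_nonneg.2 (Real.sqrt_nonneg _)) _)]

/-! ## Two representations on `ℝ¹` -/

/-- **`[ℝ, 1/(1+y²)]` exists**: rational integrand on `ℝ¹`, absolutely integrable by Mathlib's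
`integrable_inv_one_add_sq` (value `π`). [folklore] -/
theorem exists_cauchyRep₁ :
    ∃ L : IntegralRep 1, L.domain = univ ∧ L.integrand = fun y => 1 / (1 + (y 0) ^ 2) := by
  have hsa : IsSemialgebraicFunOn ℚ (univ : Set (Fin 1 → ℝ)) (fun y => 1 / (1 + (y 0) ^ 2)) := by
    refine (isSemialgebraicFunOn_aeval_div_aeval isSemialgebraic_univ (1 : MvPolynomial (Fin 1) ℚ)
      (1 + X 0 ^ 2) fun y _ => ?_).congr fun y _ => ?_
    · have hy : (0:ℝ) < 1 + (y 0) ^ 2 := by positivity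
      simpa using hy.ne'
    · simp
  have hint : IntegrableOn (fun y : Fin 1 → ℝ => 1 / (1 + (y 0) ^ 2)) univ := by
    have h := (KZ.integrableOn_setOf_apply_mem_iff (g := fun x : ℝ => 1 / (1 + x ^ 2))
      (S := univ)).2 (by simpa [one_div] using integrable_inv_one_add_sq)
    rwa [show {x : Fin 1 → ℝ | x 0 ∈ (univ : Set ℝ)} = univ from by ext; simp] at h
  exact ⟨⟨_, _, isSemialgebraic_univ, hsa, hint⟩, rfl, rfl⟩

/-- **`[(−1,1), (1 − x²)^{−1/2}]` exists** (the arcsine density): an Euler–Mellin integrand with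
rational exponent (`ℚ`-semialgebraic by `KZ.isSemialgebraicFunOn_mellinIntegrand`), absolutely
integrable on `(−1,1)` as the non-negative derivative of `arcsin`
(`intervalIntegral.integrableOn_deriv_of_nonneg`); value `π`. [folklore] -/
theorem exists_arcsineRep :
    ∃ A : IntegralRep 1, A.domain = {x | x 0 ∈ Set.Ioo (-1:ℝ) 1} ∧
      A.integrand = fun x => (1 - (x 0) ^ 2) ^ (-(1 / 2 : ℝ)) := by
  have hsa : IsSemialgebraicFunOn ℚ {x : Fin 1 → ℝ | x 0 ∈ Set.Ioo (-1:ℝ) 1}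
      (fun x => (1 - (x 0) ^ 2) ^ (-(1 / 2 : ℝ))) := by
    refine (isSemialgebraicFunOn_mellinIntegrand BallPeeling.isSemialgebraic_symIoo
      ![(1 - X 0 ^ 2 : MvPolynomial (Fin 1) ℚ)] ![-(1 / 2 : ℚ)] 1 (fun x hx k => ?_)).congr
      fun x _ => ?_
    · have hx' : -1 < x 0 ∧ x 0 < 1 := hx
      fin_cases k
      simp only [Fin.zero_eta, Matrix.cons_val_zero, map_sub, map_one, map_pow,
        MvPolynomial.aeval_X, sub_pos, sq_lt_one_iff_abs_lt_one, abs_lt]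
      exact hx'
    · simp [mellinIntegrand_apply]
  have h1 : IntegrableOn (fun x : ℝ => 1 / √(1 - x ^ 2)) (Set.Ioc (-1) 1) :=
    intervalIntegral.integrableOn_deriv_of_nonneg Real.continuous_arcsin.continuousOn
      (fun x hx => Real.hasDerivAt_arcsin hx.1.ne' hx.2.ne) fun x _ => by positivity
  have h2 : IntegrableOn (fun x : ℝ => (1 - x ^ 2) ^ (-(1 / 2 : ℝ))) (Set.Ioo (-1) 1) := by
    refine (h1.mono_set Ioo_subset_Ioc_self).congr_fun (fun x hx => ?_) measurableSet_Ioo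
    have h0 : 0 ≤ 1 - x ^ 2 := by nlinarith [hx.1, hx.2]
    show 1 / √(1 - x ^ 2) = (1 - x ^ 2) ^ (-(1 / 2 : ℝ))
    rw [Real.sqrt_eq_rpow, Real.rpow_neg h0, one_div]
  have hint := (KZ.integrableOn_setOf_apply_mem_iff
    (g := fun x : ℝ => (1 - x ^ 2) ^ (-(1 / 2 : ℝ))) (S := Set.Ioo (-1) 1)).2 h2
  exact ⟨⟨_, _, BallPeeling.isSemialgebraic_symIoo, hsa, hint⟩, rfl, rfl⟩

/-! ## `[(−1,1), 1] ∼ [pt, 2]` by one Newton–Leibniz move -/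

/-- `[−1,1] ⊆ ℝ¹` (first-coordinate spelling) is `ℚ`-semialgebraic. [folklore] -/
theorem isSemialgebraic_symIcc : IsSemialgebraic ℚ {x : Fin 1 → ℝ | x 0 ∈ Set.Icc (-1:ℝ) 1} := by
  have h1 := isSemialgebraic_setOf_eval_le (k := ℚ) (R := ℝ) (C (-1) : MvPolynomial (Fin 1) ℚ) (X 0)
  have h2 := isSemialgebraic_setOf_eval_le (k := ℚ) (R := ℝ) (X 0 : MvPolynomial (Fin 1) ℚ) 1
  have h := h1.inter h2
  have hset : {x : Fin 1 → ℝ | x 0 ∈ Set.Icc (-1:ℝ) 1} =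
      {x | aeval x (C (-1) : MvPolynomial (Fin 1) ℚ) ≤ aeval x (X 0 : MvPolynomial (Fin 1) ℚ)} ∩
        {x | aeval x (X 0 : MvPolynomial (Fin 1) ℚ) ≤ aeval x (1 : MvPolynomial (Fin 1) ℚ)} := by
    ext x
    simp
  rw [hset]
  exact h

/-- **`[(−1,1), 1] ∼ [pt, 2]`** for a representation pinned as `[(−1,1), 1]`: ONE Newton–Leibniz
move over the point (rule 3, primitive `F(t) = t` on the closed slab `[−1,1]`,
`F(1) − F(−1) = 2`), the null boundary `{−1, 1}` (rule 1a) and agreement of the integrands on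
`(−1,1)` (rule 1b). Value identity `∫_{−1}^{1} dt = 2`. [cite: KontsevichZagier2001, §1.2 rule (3)] -/
theorem symInterval_one_equivalent (I : IntegralRep 1)
    (hId : I.domain = {x | x 0 ∈ Set.Ioo (-1:ℝ) 1}) (hIi : EqOn I.integrand (fun _ => 1) I.domain) :
    Equivalent I (IntegralRep.unit.constMul ((2:ℕ):ℝ) (isAlgebraic_nat 2)) := by
  -- the closed slab `R = [[-1,1], 1]`
  obtain ⟨R, hRd, hRi⟩ : ∃ R : IntegralRep 1, R.domain = {x | x 0 ∈ Set.Icc (-1:ℝ) 1} ∧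
      R.integrand = fun _ => 1 := by
    refine ⟨⟨_, _, isSemialgebraic_symIcc, ?_, ?_⟩, rfl, rfl⟩
    · exact (isSemialgebraicFunOn_aeval isSemialgebraic_symIcc (1 : MvPolynomial (Fin 1) ℚ)).congr
        fun x _ => by simp
    · have h := (KZ.integrableOn_setOf_apply_mem_iff (g := fun _ : ℝ => (1:ℝ))
        (S := Set.Icc (-1:ℝ) 1)).2
        (integrableOn_const (hs := by rw [Real.volume_Icc]; exact ENNReal.ofReal_ne_top))
      exact h
  -- (1) Newton–Leibniz over the point: `[R] − [pt, 2]`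
  have h1 : of R - of (IntegralRep.unit.constMul ((2:ℕ):ℝ) (isAlgebraic_nat 2)) ∈ relations := by
    refine newtonLeibnizRel_subset_relations ⟨0, R, _, fun _ => (-1:ℝ), fun _ => (1:ℝ),
      fun z => z (Fin.last 0), ?_, ?_, ?_, fun _ _ => by norm_num, ?_, ?_, ?_, ?_, rfl⟩
    · exact (isSemialgebraicFunOn_aeval R.isSemialgebraic_domain (X (Fin.last 0))).congr
        fun z _ => by simp
    · exact (isSemialgebraicFunOn_aeval isSemialgebraic_univ (C (-1) : MvPolynomial (Fin 0) ℚ)).congr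
        fun x _ => by simp
    · exact (isSemialgebraicFunOn_aeval isSemialgebraic_univ (1 : MvPolynomial (Fin 0) ℚ)).congr
        fun x _ => by simp
    · rw [hRd]
      ext z
      simp only [mem_setOf_eq, mem_Icc, IntegralRep.domain_constMul, IntegralRep.unit_domain,
        mem_univ, true_and]
      rfl
    · intro x _
      simp only [Fin.snoc_last]
      exact continuousOn_id
    · intro x _ t _
      simp only [Fin.snoc_last, hRi]
      exact hasDerivAt_id' t
    · intro x _
      simp only [IntegralRep.integrand_constMul, IntegralRep.unit_integrand, Fin.snoc_last]
      norm_num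
  -- (2) the null boundary `{-1, 1}`
  have hsub : {x : Fin 1 → ℝ | x 0 ∈ Set.Ioo (-1:ℝ) 1} ⊆ R.domain := by
    rw [hRd]
    exact fun x hx => Ioo_subset_Icc_self hx
  have h2 : of R - of (R.restrict _ BallPeeling.isSemialgebraic_symIoo hsub) ∈ relations := by
    refine R.of_sub_of_restrict_mem_relations BallPeeling.isSemialgebraic_symIoo hsub
      (measure_mono_null (fun x hx => ?_) (measure_union_null
        (BallPeeling.volume_setOf_apply_eq_const 1 0 (-1))
        (BallPeeling.volume_setOf_apply_eq_const 1 0 1)))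
    rw [hRd] at hx
    obtain ⟨⟨h0, h1⟩, h3⟩ := hx
    simp only [mem_setOf_eq, mem_Ioo, not_and, not_lt] at h3
    simp only [mem_union, mem_setOf_eq]
    rcases h0.lt_or_eq with h0 | h0
    · exact Or.inr (le_antisymm h1 (h3 h0))
    · exact Or.inl h0.symm
  -- (3) same domain, same integrand on it
  have h3 : of I - of (R.restrict _ BallPeeling.isSemialgebraic_symIoo hsub) ∈ relations := by
    refine of_sub_of_mem_relations_of_eqOn (by rw [IntegralRep.domain_restrict, hId]) fun x hx => ?_
    rw [hIi hx, IntegralRep.integrand_restrict, hRi]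
  have : of I - of (IntegralRep.unit.constMul ((2:ℕ):ℝ) (isAlgebraic_nat 2)) =
      (of I - of (R.restrict _ BallPeeling.isSemialgebraic_symIoo hsub)) -
        (of R - of (R.restrict _ BallPeeling.isSemialgebraic_symIoo hsub)) +
        (of R - of (IntegralRep.unit.constMul ((2:ℕ):ℝ) (isAlgebraic_nat 2))) := by abel
  rw [Equivalent, this]
  exact relations.add_mem (relations.sub_mem h3 h2) h1

/-! ## `2 · ⟦[pt, 1/2]⟧ = 1` -/

/-- **`2 · ⟦[pt, 1/2]⟧ = 1`** in the formal period ring: `⟦[pt, 2]⟧ = 2`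
(`KZ.toFormalPeriod_of_unit_constMul_natCast`) and `[pt, 2] × [pt, 1/2]` has the domain and the
integrand of `[pt, 1]`. [cite: KontsevichZagier2001, §4.1] -/
theorem two_mul_toFormalPeriod_unit_constMul_half (h : IsAlgebraic ℚ ((2:ℝ)⁻¹)) :
    (2 : FormalPeriodRing) * toFormalPeriod (of (IntegralRep.unit.constMul ((2:ℝ)⁻¹) h)) = 1 := by
  have h2 : IsAlgebraic ℚ ((2:ℕ):ℝ) := isAlgebraic_nat 2
  have h1 : toFormalPeriod (of (IntegralRep.unit.constMul ((2:ℕ):ℝ) h2)) = (2 : FormalPeriodRing) := by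
    have := toFormalPeriod_of_unit_constMul_natCast 2 h2
    simpa using this
  have hprod : toFormalPeriod (of (IntegralRep.unit.constMul ((2:ℕ):ℝ) h2)) *
      toFormalPeriod (of (IntegralRep.unit.constMul ((2:ℝ)⁻¹) h)) =
        toFormalPeriod (of IntegralRep.unit) := by
    rw [toFormalPeriod_of_mul_of]
    apply toFormalPeriod_eq_iff.mpr
    refine of_sub_of_mem_relations_of_eqOn ?_ fun z _ => ?_
    · ext z
      simp [IntegralRep.prodDomain]
    · rw [IntegralRep.prod_integrand_eq]
      simp [IntegralRep.prodFun]
  rw [← h1, hprod, toFormalPeriod_of_unit]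

end Summit.KontsevichZagierPeriods.CobordismMove.CP2Volume

end
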